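import Literature.Analysis.FluidPDE.LeiZhang2011RegularityCase2
import Literature.Analysis.FluidPDE.PeriodicCylinderFrameInversion
import HarnessLib

/-!
# Lei–Zhang 2011, Theorem 1.4, Case 2 — with the swirl bounded only in a tube near the final time

Analysis/FluidPDE **proofs file** (theorems only: no definitions, no named facts, no `sorry`),
companion of `LeiZhang2011RegularityCase2` on the discharge path of
`Literature.Analysis.FluidPDE.LeiZhang2011_regularity_bmoStream` (Z. Lei, Q. S. Zhang,
J. Funct. Anal. 261 (2011) = arXiv:1011.5066, Theorem 1.4, proof §4, Case 2, pp. 12–13).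

`case2_falseLoc` is `case2_false` with the hypothesis `|Γ| ≤ C₁` on all of `(0, T) × ℝ³`
replaced by the bound in a **tube around the axis near the final time** (`t ∈ (T₁, T)`,
`r(x) ≤ ρ`), for near-maxima in the half tube `r(x_n) ≤ ρ/2` with `t_n → T`, `M_n → ∞`: the swirl
bound enters only the estimate of the tangential component of the rescaled fields
(`zoomAt_abs_apply_one_le_pt`, the bound at the one physical point `x_n + c_n y`), consumed in the
blow-up limit pointwise and eventually along the sequence, when `x_n + c_n y` is in the tube.
[cite: LeiZhang2011, Thm. 1.4, proof §4, Case 2 (arXiv pp. 12–13)]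

## References

* Z. Lei, Q. S. Zhang, J. Funct. Anal. 261 (2011) = arXiv:1011.5066: Thm. 1.4 proof §4 Case 2,
  §2 (2.6). [LeiZhang2011]
-/

noncomputable section

open MeasureTheory Set Function Filter Topology TopologicalSpace Metric
open scoped InnerProductSpace RealInnerProductSpace NNReal ENNReal

namespace Literature.Analysis.FluidPDE

open Literature.Analysis.FunctionSpaces SereginSverak2009

section OffAxis

variable {T : ℝ} {u : ℝ → EuclideanSpace ℝ (Fin 3) → EuclideanSpace ℝ (Fin 3)}
  {p : ℝ → EuclideanSpace ℝ (Fin 3) → ℝ} {t₀ c : ℝ} {x₀ : EuclideanSpace ℝ (Fin 3)}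

/-- **The tangential component of the off-axis zoom, with the swirl bound at one point**
(`zoomAt_abs_apply_one_le` with `|swirl u| ≤ C₁` assumed only at the physical point
`x₀ + c y`). [cite: LeiZhang2011, Thm. 1.4, proof §4, Case 2 (arXiv pp. 12–13)] -/
theorem zoomAt_abs_apply_one_le_pt (hx : x₀ 1 = 0) {M : ℝ} (hM : 0 < M) (hc : c = M⁻¹) {s : ℝ} {C₁ : ℝ}
    (hbd : ∀ x, ‖u (t₀ + c ^ 2 * s) x‖ ≤ 2 * M) {y : EuclideanSpace ℝ (Fin 3)}
    (hswirl : |swirl (u (t₀ + c ^ 2 * s)) (x₀ + c • y)| ≤ C₁)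
    (hy : |y 0| < M * x₀ 0) :
    |(c • stPull (c ^ 2) c t₀ x₀ u) s y 1| ≤ (C₁ + 2 * |y 1|) / (M * x₀ 0 - |y 0|) := by
  have hc0 : 0 < c := by rw [hc]; positivity
  set x : EuclideanSpace ℝ (Fin 3) := x₀ + c • y with hxdef
  set w : EuclideanSpace ℝ (Fin 3) := u (t₀ + c ^ 2 * s) x with hw
  have hx0 : x 0 = x₀ 0 + c * y 0 := by simp [hxdef]
  have hx1 : x 1 = c * y 1 := by simp [hxdef, hx]
  have hden : 0 < M * x₀ 0 - |y 0| := by linarith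
  have hx0pos : 0 < x 0 := by
    rw [hx0, hc]
    have : M⁻¹ * (M * x₀ 0 - |y 0|) ≤ x₀ 0 + M⁻¹ * y 0 := by
      rw [mul_sub, ← mul_assoc, inv_mul_cancel₀ hM.ne', one_mul]
      linarith [neg_abs_le (y 0), mul_le_mul_of_nonneg_left (neg_abs_le (y 0)) (inv_pos.2 hM).le]
    nlinarith [mul_pos (inv_pos.2 hM) hden]
  -- `u₁ = (Γ + x₁ u₀) / x₀`
  have hsw : swirl (u (t₀ + c ^ 2 * s)) x = x 0 * w 1 - x 1 * w 0 := rfl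
  have hw1 : w 1 = (swirl (u (t₀ + c ^ 2 * s)) x + x 1 * w 0) / x 0 := by
    rw [hsw]; field_simp; ring
  have hV1 : (c • stPull (c ^ 2) c t₀ x₀ u) s y 1 = c * w 1 := by
    rw [smul_stPull_apply]; simp [hw, hxdef]
  have hw0 : |w 0| ≤ 2 * M := by
    calc |w 0| = ‖w 0‖ := (Real.norm_eq_abs _).symm
      _ ≤ ‖w‖ := PiLp.norm_apply_le w 0
      _ ≤ 2 * M := hbd x
  rw [hV1, hw1, abs_mul, abs_of_pos hc0, abs_div, abs_of_pos hx0pos]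
  -- `c (|Γ| + |x₁| |u₀|) / x₀ ≤ (C₁ + 2|y₁|) / (M x₀₀ − |y₀|)`
  have hnum : |swirl (u (t₀ + c ^ 2 * s)) x + x 1 * w 0| ≤ C₁ + c * |y 1| * (2 * M) := by
    calc |swirl (u (t₀ + c ^ 2 * s)) x + x 1 * w 0|
        ≤ |swirl (u (t₀ + c ^ 2 * s)) x| + |x 1 * w 0| := abs_add_le _ _
      _ ≤ C₁ + |x 1| * |w 0| := by rw [abs_mul]; exact add_le_add (hswirl) le_rfl
      _ ≤ C₁ + c * |y 1| * (2 * M) := by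
          rw [hx1, abs_mul, abs_of_pos hc0]
          gcongr
  rw [← mul_div_assoc, div_le_div_iff₀ hx0pos hden]
  have h2 : c * |swirl (u (t₀ + c ^ 2 * s)) x + x 1 * w 0| * (M * x₀ 0 - |y 0|) ≤
      (C₁ + c * |y 1| * (2 * M)) * (c * (M * x₀ 0 - |y 0|)) := by
    have := mul_le_mul_of_nonneg_right hnum (mul_nonneg hc0.le hden.le)
    nlinarith [this]
  have h3 : c * (M * x₀ 0 - |y 0|) ≤ x 0 := by
    rw [hx0, hc, mul_sub, ← mul_assoc, inv_mul_cancel₀ hM.ne', one_mul]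
    nlinarith [neg_abs_le (y 0), le_abs_self (y 0), inv_pos.2 hM]
  have h4 : c * |y 1| * (2 * M) = 2 * |y 1| := by rw [hc]; field_simp
  calc c * |swirl (u (t₀ + c ^ 2 * s)) x + x 1 * w 0| * (M * x₀ 0 - |y 0|)
      ≤ (C₁ + c * |y 1| * (2 * M)) * (c * (M * x₀ 0 - |y 0|)) := h2
    _ ≤ (C₁ + c * |y 1| * (2 * M)) * x 0 := by
        refine mul_le_mul_of_nonneg_left h3 ?_
        have : 0 ≤ C₁ := (abs_nonneg _).trans (hswirl)
        positivity
    _ = (C₁ + 2 * |y 1|) * x 0 := by rw [h4]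


end OffAxis

/-- **Lei–Zhang 2011, Theorem 1.4, Case 2 (`r_k Q_k → ∞`) leads to a contradiction — swirl
bounded in a tube near the final time.** As `case2_false`, for a classical solution on
`(0, T) × ℝ³` with axisymmetric slices and a stream function with `BMO` slices, but with
`|Γ(t, x)| ≤ C₁` assumed only for `t ∈ (T₁, T)`, `r(x) ≤ ρ`, and near-maxima in the half tube
`r(x_n) ≤ ρ/2` (meridian representatives, `(x_n)₁ = 0`) with `t_n → T`, `M_n → ∞`,
`M_n (x_n)₀ → ∞`. [cite: LeiZhang2011, Thm. 1.4, proof §4, Case 2 (arXiv pp. 12–13)] -/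
theorem case2_falseLoc {T : ℝ} {u : ℝ → EuclideanSpace ℝ (Fin 3) → EuclideanSpace ℝ (Fin 3)}
    {p : ℝ → EuclideanSpace ℝ (Fin 3) → ℝ}
    (h : IsClassicalNSSolutionOn (Ioo 0 T) 1 0 u p)
    (haxi : ∀ t ∈ Ioo 0 T, IsAxisymmetric (u t))
    {C₁ T₁ ρ : ℝ} (hT₁ : T₁ < T) (hρ : 0 < ρ)
    (hΓ : ∀ t ∈ Ioo T₁ T, ∀ x, cylRadius x ≤ ρ → |swirl (u t) x| ≤ C₁)
    {Bs : ℝ → EuclideanSpace ℝ (Fin 3) → EuclideanSpace ℝ (Fin 3)} {Kb : ℝ≥0}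
    (hBs : HasBMOStreamFunctionOn (Ioo 0 T) u Bs Kb)
    {tn : ℕ → ℝ} {xn : ℕ → EuclideanSpace ℝ (Fin 3)} (htn : ∀ n, tn n ∈ Ioo 0 T)
    (htnT : Tendsto tn atTop (𝓝 T))
    (hx1 : ∀ n, xn n 1 = 0) (hrn : ∀ n, cylRadius (xn n) ≤ ρ / 2)
    (hMpos : ∀ n, 0 < ‖u (tn n) (xn n)‖)
    (hMtop : Tendsto (fun n => ‖u (tn n) (xn n)‖) atTop atTop)
    (hmax : ∀ n, ∀ s ∈ Ioc 0 (tn n), ∀ y, ‖u s y‖ ≤ 2 * ‖u (tn n) (xn n)‖)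
    (hA2 : ∀ n, 2 ≤ tn n * ‖u (tn n) (xn n)‖ ^ 2)
    (hAtop : Tendsto (fun n => tn n * ‖u (tn n) (xn n)‖ ^ 2) atTop atTop)
    (hR : Tendsto (fun n => ‖u (tn n) (xn n)‖ * xn n 0) atTop atTop) : False := by
  -- the uniform Lipschitz constant on unit windows at the bound `2`
  obtain ⟨K, hK0, hKprop⟩ :=
    KNSS2009_regularity_boundedWeak_window_holds.lipschitz_of_bmoStream 2
  set M : ℕ → ℝ := fun n => ‖u (tn n) (xn n)‖ with hMdef
  set c : ℕ → ℝ := fun n => (M n)⁻¹ with hcdef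
  have hcpos : ∀ n, 0 < c n := fun n => inv_pos.2 (hMpos n)
  have hceq : ∀ n, c n = ‖u (tn n) (xn n)‖⁻¹ := fun n => rfl
  have hcinv : ∀ n, (c n)⁻¹ = M n := fun n => inv_inv _
  set A : ℕ → ℝ := fun n => -(tn n / c n ^ 2) with hAdef
  set B : ℕ → ℝ := fun n => (T - tn n) / c n ^ 2 with hBdef
  have hAeq : ∀ n, A n = -(tn n * M n ^ 2) := fun n => by
    simp only [hAdef, hcdef, inv_pow, div_inv_eq_mul]
  have hA2' : ∀ n, A n ≤ -2 := fun n => by rw [hAeq]; linarith [hA2 n]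
  have hBpos : ∀ n, 0 < B n := fun n => div_pos (by linarith [(htn n).2]) (pow_pos (hcpos n) 2)
  have hAtend : Tendsto A atTop atBot := by
    have : A = fun n => -(tn n * M n ^ 2) := funext hAeq
    rw [this]
    exact tendsto_neg_atTop_atBot.comp hAtop
  -- the rescaled solutions, centred at the near-maxima
  set V : ℕ → ℝ → EuclideanSpace ℝ (Fin 3) → EuclideanSpace ℝ (Fin 3) :=
    fun n => c n • stPull (c n ^ 2) (c n) (tn n) (xn n) u with hVdef
  set P : ℕ → ℝ → EuclideanSpace ℝ (Fin 3) → ℝ :=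
    fun n => c n ^ 2 • stPull (c n ^ 2) (c n) (tn n) (xn n) p with hPdef
  have hVcl : ∀ n, IsClassicalNSSolutionOn (Ioo (A n) (B n)) 1 0 (V n) (P n) := fun n =>
    zoomAt_isClassicalNSSolutionOn h (hcpos n) (tn n) (xn n)
  have hVbd : ∀ n, ∀ s ∈ Ioc (A n) 0, ∀ y, ‖V n s y‖ ≤ 2 := fun n =>
    zoomAt_norm_le_two (hmax n) (hMpos n) (hceq n)
  have hVmem : ∀ n, ∀ s ∈ Ioo (A n) (B n), tn n + c n ^ 2 * s ∈ Ioo 0 T := fun n s hs =>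
    zoom_time_mem (hcpos n).ne' hs
  have hVstream : ∀ n, HasBMOStreamFunctionOn (Ioo (A n) (B n)) (V n)
      (stPull (c n ^ 2) (c n) (tn n) (xn n) Bs) Kb := fun n =>
    zoomAt_hasBMOStreamFunctionOn hBs (hcpos n).ne' (tn n) (xn n)
  have hVone : ∀ n, ‖V n 0 0‖ = 1 := fun n => norm_zoomAt_apply_zero_zero (hMpos n) (hceq n)
  have hVcont : ∀ n, ContinuousOn (uncurry (V n)) (Ioo (A n) (B n) ×ˢ univ) := fun n =>
    (hVcl n).smooth_velocity.continuousOn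
  have hVsym : ∀ n, ∀ s ∈ Ioo (A n) (B n), ∀ (θ : ℝ) (y : EuclideanSpace ℝ (Fin 3)),
      V n s (EuclideanSpace.single 0 (-((c n)⁻¹ * xn n 0)) +
        rotZ θ (y - EuclideanSpace.single 0 (-((c n)⁻¹ * xn n 0)))) = rotZ θ (V n s y) :=
    fun n s hs θ y => zoomAt_rot_about (hx1 n) (hcpos n).ne' (haxi _ (hVmem n s hs)) θ y
  -- the bound on the tangential component, where the physical point is in the tube and the
  -- physical time in `(T₁, T)`
  have hVtan : ∀ n, ∀ s ∈ Ioo (A n) (B n), s ≤ 0 → ∀ y : EuclideanSpace ℝ (Fin 3),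
      |y 0| < M n * xn n 0 → tn n + c n ^ 2 * s ∈ Ioo T₁ T → c n * ‖y‖ ≤ ρ / 2 →
        |V n s y 1| ≤ (C₁ + 2 * |y 1|) / (M n * xn n 0 - |y 0|) :=
    fun n s hs hs0 y hy hsT hyρ => zoomAt_abs_apply_one_le_pt (hx1 n) (hMpos n) (hceq n)
      (hmax n _ (zoom_time_mem_Ioc (hcpos n).ne' ⟨hs.1, hs0⟩)) (hΓ _ hsT _ (by
        calc cylRadius (xn n + c n • y) ≤ cylRadius (xn n) + cylRadius (c n • y) :=
              cylRadius_add_le _ _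
          _ ≤ ρ / 2 + c n * ‖y‖ := by
              rw [cylRadius_smul, abs_of_pos (hcpos n)]
              exact add_le_add (hrn n)
                (mul_le_mul_of_nonneg_left (cylRadius_le_norm y) (hcpos n).le)
          _ ≤ ρ := by linarith)) hy
  -- `c_n → 0`
  have hc0 : Tendsto c atTop (𝓝 0) := tendsto_inv_atTop_zero.comp hMtop
  have hVdiv : ∀ n, ∀ s ∈ Ioo (A n) (B n), IsWeaklyDivFree (V n s) := fun n s hs =>
    ((hVcl n).divFree s hs).isWeaklyDivFree_holds
      (((hVcl n).contDiff_velocity hs).of_le (by exact_mod_cast le_top))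
  -- uniform Lipschitz bound on `[A n + 1, 0] × ℝ³`, and the clamped maps
  have hLip : ∀ n, ∀ s ∈ Icc (A n + 1) 0, ∀ t ∈ Icc (A n + 1) 0, ∀ x y,
      ‖V n t x - V n s y‖ ≤ max K 8 * (|t - s| + ‖x - y‖) := fun n =>
    lipschitz_up_to_final_time_of_bmoStream hKprop (hA2' n) (hBpos n) (hVcl n) (hVbd n)
      ⟨_, Kb, hVstream n⟩
  set W : ℕ → ℝ × EuclideanSpace ℝ (Fin 3) → EuclideanSpace ℝ (Fin 3) :=
    fun n z => V n (max (A n + 1) (min z.1 0)) z.2 with hWdef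
  have hK8 : 0 ≤ max K 8 := hK0.trans (le_max_left _ _)
  have hK8pos : 0 < max K 8 := lt_of_lt_of_le (by norm_num) (le_max_right _ _)
  have hWlip : ∀ n, LipschitzWith (Real.toNNReal (2 * max K 8)) (W n) := fun n =>
    lipschitzWith_clamp hK8 (by linarith [hA2' n]) (hLip n)
  have hclamp : ∀ n (r : ℝ), max (A n + 1) (min r 0) ∈ Ioc (A n) 0 := fun n r =>
    ⟨by linarith [le_max_left (A n + 1) (min r 0)],
      max_le (by linarith [hA2' n]) (min_le_right _ _)⟩
  have hWball : ∀ n z, W n z ∈ closedBall (0 : EuclideanSpace ℝ (Fin 3)) 2 := fun n z =>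
    mem_closedBall_zero_iff.2 (hVbd n _ (hclamp n z.1) z.2)
  -- extraction: pointwise convergence of the clamped maps
  obtain ⟨φ, Winf, hφ, hWinflip, -, hWconv⟩ :=
    exists_strictMono_tendsto_of_lipschitzWith W hWlip hWball
  have hAφ : Tendsto (fun m => A (φ m)) atTop atBot := hAtend.comp hφ.tendsto_atTop
  have hevA : ∀ t : ℝ, ∀ᶠ m in atTop, A (φ m) + 1 ≤ t := fun t =>
    (hAφ.eventually (eventually_le_atBot (t - 1))).mono fun m hm => by linarith
  -- the limit field
  set v : ℝ → EuclideanSpace ℝ (Fin 3) → EuclideanSpace ℝ (Fin 3) := fun t x => Winf (t, x)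
    with hvdef
  have hvcont : Continuous (uncurry v) := hWinflip.continuous
  have hVlim : ∀ t ≤ 0, ∀ x, Tendsto (fun m => V (φ m) t x) atTop (𝓝 (v t x)) := by
    intro t ht x
    refine (hWconv (t, x)).congr' ((hevA t).mono fun m hm => ?_)
    show V (φ m) (max (A (φ m) + 1) (min t 0)) x = V (φ m) t x
    rw [min_eq_left ht, max_eq_right hm]
  have hevmem : ∀ t < 0, ∀ᶠ m in atTop, t ∈ Ioo (A (φ m)) (B (φ m)) := fun t ht =>
    (hevA t).mono fun m hm => ⟨by linarith, ht.trans (hBpos _)⟩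
  -- the limit is a bounded weak solution on `(-∞, 0)` with weakly divergence-free slices
  have hweak : IsBoundedWeakNSSolutionOn (Iio 0) isOpen_Iio 1 v := by
    refine isBoundedWeakNSSolutionOn_of_tendsto (A := fun m => A (φ m)) (V := fun m => V (φ m))
      (M := 2) hAφ (fun m => ?_) (fun m => ?_) (fun m s hs y => hVbd (φ m) s ⟨hs.1, hs.2.le⟩ y)
      hvcont (fun t ht x => hVlim t ht.le x)
    · have hcl : IsClassicalNSSolutionOn (Ioo (A (φ m)) 0) 1 0 (V (φ m)) (P (φ m)) :=
        (hVcl (φ m)).mono (Ioo_subset_Ioo_right (hBpos _).le) (uniqueDiffOn_Ioo _ _)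
      exact hcl.isBoundedWeakNSSolutionOn ⟨2, fun s hs y => hVbd (φ m) s ⟨hs.1, hs.2.le⟩ y⟩
    · exact (hVcont (φ m)).mono (prod_mono (Ioo_subset_Ioo_right (hBpos _).le) Subset.rfl)
  have hdiv : ∀ t < 0, IsWeaklyDivFree (v t) :=
    isWeaklyDivFree_of_tendsto (M := 2) (A := fun m => A (φ m)) (V := fun m => V (φ m)) hAφ
      (fun m t ht => hVdiv (φ m) t ⟨ht.1, ht.2.trans (hBpos _)⟩)
      (fun m => (hVcont (φ m)).mono (prod_mono (Ioo_subset_Ioo_right (hBpos _).le) Subset.rfl))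
      (fun m t ht y => hVbd (φ m) t ⟨ht.1, ht.2.le⟩ y) (fun t ht x => hVlim t ht.le x)
  -- at a fixed `t < 0`: the shifted approximating slices converge locally uniformly
  have hshift : ∀ t < 0, ∃ k₀ : ℕ, (∀ k, t ∈ Ioo (A (φ (k + k₀))) (B (φ (k + k₀)))) ∧
      TendstoLocallyUniformly (fun k => V (φ (k + k₀)) t) (v t) atTop ∧
      ∀ r : ℝ, TendstoUniformlyOn (fun k => V (φ (k + k₀)) t) (v t) atTop
        (closedBall (0 : EuclideanSpace ℝ (Fin 3)) r) := by
    intro t ht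
    obtain ⟨k₀, hk₀⟩ := eventually_atTop.1 ((hevmem t ht).and (hevA t))
    have hmem : ∀ k, t ∈ Ioo (A (φ (k + k₀))) (B (φ (k + k₀))) := fun k =>
      (hk₀ (k + k₀) (by omega)).1
    have hAk : ∀ k, A (φ (k + k₀)) + 1 ≤ t := fun k => (hk₀ (k + k₀) (by omega)).2
    have hconvpt : ∀ x, Tendsto (fun k => V (φ (k + k₀)) t x) atTop (𝓝 (v t x)) := fun x =>
      (hVlim t ht.le x).comp (tendsto_add_atTop_nat k₀)
    have hlipx : ∀ k x y, ‖V (φ (k + k₀)) t x - V (φ (k + k₀)) t y‖ ≤ max K 8 * ‖x - y‖ :=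
      fun k x y => by
        have := hLip (φ (k + k₀)) t ⟨hAk k, ht.le⟩ t ⟨hAk k, ht.le⟩ x y
        simpa using this
    exact ⟨k₀, hmem, tendstoLocallyUniformly_of_lipschitz_of_tendsto hK8pos hlipx hconvpt⟩
  -- invariance along `e₂`: the axes recede
  have hinv : ∀ t < 0, ∀ (x : EuclideanSpace ℝ (Fin 3)) (δ : ℝ),
      v t (x + EuclideanSpace.single 1 δ) = v t x := by
    intro t ht x δ
    obtain ⟨k₀, hmem, hLU, -⟩ := hshift t ht
    have hRk : Tendsto (fun k => (c (φ (k + k₀)))⁻¹ * xn (φ (k + k₀)) 0) atTop atTop := by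
      simp only [hcinv]
      exact hR.comp (hφ.tendsto_atTop.comp (tendsto_add_atTop_nat k₀))
    exact eq_of_tendstoLocallyUniformly_of_rot_about hRk
      (fun k θ y => hVsym (φ (k + k₀)) t (hmem k) θ y) hLU
      (hvcont.comp (Continuous.prodMk_right t)) x δ
  -- the tangential component vanishes in the limit
  have htan : ∀ t < 0, ∀ x, v t x 1 = 0 := by
    intro t ht x
    obtain ⟨k₀, hmem, -, -⟩ := hshift t ht
    have hRk : Tendsto (fun k => M (φ (k + k₀)) * xn (φ (k + k₀)) 0) atTop atTop :=
      hR.comp (hφ.tendsto_atTop.comp (tendsto_add_atTop_nat k₀))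
    have hlim1 : Tendsto (fun k => |V (φ (k + k₀)) t x 1|) atTop (𝓝 |v t x 1|) :=
      (((PiLp.continuous_apply 2 _ 1).tendsto _).comp
        ((hVlim t ht.le x).comp (tendsto_add_atTop_nat k₀))).abs
    have hbound : Tendsto (fun k => (C₁ + 2 * |x 1|) / (M (φ (k + k₀)) * xn (φ (k + k₀)) 0 - |x 0|))
        atTop (𝓝 0) := by
      refine Tendsto.div_atTop tendsto_const_nhds ?_
      simpa only [sub_eq_add_neg] using tendsto_atTop_add_const_right _ (-|x 0|) hRk
    -- eventually the physical time is in `(T₁, T)` and the physical point in the tube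
    have hφk : Tendsto (fun k => φ (k + k₀)) atTop atTop :=
      hφ.tendsto_atTop.comp (tendsto_add_atTop_nat k₀)
    have hck : Tendsto (fun k => c (φ (k + k₀))) atTop (𝓝 0) := hc0.comp hφk
    have htk : Tendsto (fun k => tn (φ (k + k₀)) + c (φ (k + k₀)) ^ 2 * t) atTop (𝓝 T) := by
      have h1 : Tendsto (fun k => tn (φ (k + k₀))) atTop (𝓝 T) := htnT.comp hφk
      have h2 : Tendsto (fun k => c (φ (k + k₀)) ^ 2 * t) atTop (𝓝 (0 ^ 2 * t)) :=
        (hck.pow 2).mul_const t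
      simpa using h1.add h2
    have hev1 : ∀ᶠ k in atTop, tn (φ (k + k₀)) + c (φ (k + k₀)) ^ 2 * t ∈ Ioo T₁ T := by
      have hlt : ∀ k, tn (φ (k + k₀)) + c (φ (k + k₀)) ^ 2 * t < T := fun k => by
        have : c (φ (k + k₀)) ^ 2 * t < 0 := mul_neg_of_pos_of_neg (pow_pos (hcpos _) 2) ht
        linarith [(htn (φ (k + k₀))).2]
      exact (htk.eventually (lt_mem_nhds hT₁)).mono fun k hk => ⟨hk, hlt k⟩
    have hev2 : ∀ᶠ k in atTop, c (φ (k + k₀)) * ‖x‖ ≤ ρ / 2 := by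
      have h1 : Tendsto (fun k => c (φ (k + k₀)) * ‖x‖) atTop (𝓝 (0 * ‖x‖)) := hck.mul_const _
      rw [zero_mul] at h1
      exact h1.eventually (ge_mem_nhds (by linarith))
    have hev : ∀ᶠ k in atTop, |V (φ (k + k₀)) t x 1| ≤
        (C₁ + 2 * |x 1|) / (M (φ (k + k₀)) * xn (φ (k + k₀)) 0 - |x 0|) := by
      filter_upwards [hRk.eventually (eventually_gt_atTop |x 0|), hev1, hev2] with k hk hk1 hk2
      exact hVtan (φ (k + k₀)) t (hmem k) ht.le x hk hk1 hk2
    have h0 : |v t x 1| ≤ 0 := le_of_tendsto_of_tendsto hlim1 hbound hev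
    exact abs_nonpos_iff.1 h0
  -- `BMO` stream functions along the approximating slices
  have happrox : ∀ t < 0, ∃ (w B' : ℕ → EuclideanSpace ℝ (Fin 3) → EuclideanSpace ℝ (Fin 3))
      (K' : ℝ≥0), (∀ k, Differentiable ℝ (B' k)) ∧ (∀ k, curl (B' k) =ᵐ[volume] w k) ∧
      (∀ k, eBMOSeminormVec (B' k) ≤ K') ∧ (∀ k, LocallyIntegrable (w k) volume) ∧
      ∀ r : ℝ, 0 < r →
        TendstoUniformlyOn w (v t) atTop (closedBall (0 : EuclideanSpace ℝ (Fin 3)) r) := by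
    intro t ht
    obtain ⟨k₀, hmem, -, hU⟩ := hshift t ht
    have hstr : ∀ k, Differentiable ℝ (stPull (c (φ (k + k₀)) ^ 2) (c (φ (k + k₀)))
        (tn (φ (k + k₀))) (xn (φ (k + k₀))) Bs t) ∧
        curl (stPull (c (φ (k + k₀)) ^ 2) (c (φ (k + k₀))) (tn (φ (k + k₀))) (xn (φ (k + k₀)))
          Bs t) =ᵐ[volume] V (φ (k + k₀)) t ∧
        eBMOSeminormVec (stPull (c (φ (k + k₀)) ^ 2) (c (φ (k + k₀))) (tn (φ (k + k₀)))
          (xn (φ (k + k₀))) Bs t) ≤ Kb := fun k => hVstream (φ (k + k₀)) t (hmem k)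
    have hwc : ∀ k, Continuous (V (φ (k + k₀)) t) := fun k =>
      (hVcont (φ (k + k₀))).comp_continuous (Continuous.prodMk_right t)
        fun x => ⟨hmem k, mem_univ x⟩
    exact ⟨fun k => V (φ (k + k₀)) t, fun k => stPull (c (φ (k + k₀)) ^ 2) (c (φ (k + k₀)))
        (tn (φ (k + k₀))) (xn (φ (k + k₀))) Bs t, Kb, fun k => (hstr k).1,
      fun k => (hstr k).2.1, fun k => (hstr k).2.2, fun k => (hwc k).locallyIntegrable,
      fun r _ => hU r⟩
  -- Case 2 for the limit: `v = 0` up to `t = 0`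
  have hv0 := case2_limit_eq_zero hweak hvcont hdiv hinv htan happrox
  -- but `‖v(0, 0)‖ = lim ‖V_n(0, 0)‖ = 1`
  have hnorm1 : ‖Winf (0, 0)‖ = 1 := by
    have h1 : Tendsto (fun m => ‖W (φ m) (0, 0)‖) atTop (𝓝 ‖Winf (0, 0)‖) := (hWconv (0, 0)).norm
    have h2 : ∀ m, ‖W (φ m) (0, 0)‖ = 1 := fun m => by
      show ‖V (φ m) (max (A (φ m) + 1) (min 0 0)) 0‖ = 1
      rw [min_self, max_eq_right (by linarith [hA2' (φ m)])]
      exact hVone (φ m)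
    refine tendsto_nhds_unique h1 ?_
    simp_rw [h2]
    exact tendsto_const_nhds
  have hv0' : Winf (0, 0) = 0 := hv0 0 le_rfl 0
  rw [hv0', norm_zero] at hnorm1
  exact zero_ne_one hnorm1


end Literature.Analysis.FluidPDE
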